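import Literature.AlgebraicGeometry.ModuliOfAbelianVarieties.SiegelFamilyHumbertModularEquivariance
import Literature.AlgebraicGeometry.ModuliOfAbelianVarieties.SiegelFamilyHumbertLocusOrbit
import HarnessLib

/-!
# The pullback of `Sp₄(ℤ)` under Runge's lift is the Hilbert modular group `SL(O ⊕ O^∨)`:
# `x ∈ O ⟺ A(x) ∈ M₂(ℤ)` and its three companions for the blocks `ᵗR diag(b) R`, `ᵗS diag(c) S`, `ᵗS diag(d) R`

Layer `Literature/AlgebraicGeometry/ModuliOfAbelianVarieties`, namespace
`Literature.AlgebraicGeometry.ModuliOfAbelianVarieties.SiegelModuli`; lane `lit-hodgefound` (Track 2 foundations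
library, Layer A4), seat `lit-hodgefound-skel-4`, row **A4-70**, FILE 4 (rider; one definition with body + theorems,
no named fact). Sequel of FILE 3 (`SiegelFamilyHumbertModularEquivariance`: `slPairSp = σ`, `rungeConj`,
`modularEmbeddingLift`, `modularEmbeddingLiftHom`, `coe_modularEmbeddingLift`, `modularEmbedding_smul`,
`transpose_rungeMatrix_mul_diagonal_mul_dualRungeMatrix : ᵗR diag(σ(x)) S = A(x)`), of rows A4-64/A4-66
(`rungeMatrix = R`, `dualRungeMatrix = S = ᵗR⁻¹` — the real embeddings of the dual basis `ω₁^∨ = (ω − l)/(2ω − l)`,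
`ω₂^∨ = 1/(2ω − l)` of `O^∨`, `realEmb_sqrtDisc_mul_dualRungeMatrix_mulVec`), A4-67 (`realEmb`, `regRep = A(·)`) and
A4-16 (`gDHom`, `symplecticLatticeGroup`, `spUnit`, `toGD_one_eq_transpose`), all BY NAME.

## Source, verbatim

B. Runge, Tohoku Math. J. 51 (1999), §4 p. 290 (held `paper:doi-10-2748-tmj-1178224764` p0008 L36–L41): "Let `x ∈ F`
be arbitrary. Then `xω_i = Σ_j A_{ij} ω_j` for some matrix `A(x) = (A_{ij}) ∈ M_n(ℚ)`. It is easy to check that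
`A(x) = ᵗR σ(x) ᵗR⁻¹` and `x ∈ O ⟺ A(x) ∈ M₂(ℤ)`"; p. 291: "By taking the quotient `Γ(F)\H(F)`, we get the standard
model for Humbert surfaces. The Humbert modular group `Γ(F) = Γ(Δ)` …"; N. Elkies, A. Kumar, Algebra & Number Theory 8
(2014), §3: the Hilbert modular surface of discriminant `D` is `SL(O_D ⊕ O_D^*)\ℍ²`, `O_D^*` the inverse different,
mapping to `𝒜₂`; C. T. McMullen, J. AMS 16 (2003), §6.

## What is proved (one definition with body + theorems; NO named fact, NO sorry, net debt 0)

Write `δ = 2ω − l` (`σ₁(δ) = √Δ = −σ₂(δ)`, `O^∨ = δ⁻¹O`), `R = (σ_s(ω_j))`, `S = ᵗR⁻¹ = (σ_s(ω_j^∨))`,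
`P = (−l 1; 1 0) ∈ GL₂(ℤ)` (the dual basis in terms of `(1, ω)/δ`).
* §1 `realEmb_delta_zero/one/ne_zero`, **`diagonal_realEmb_delta_mul_dualRungeMatrix`** (`diag(σ(δ)) S = R P`: the KEY
  identity `δ·ω_j^∨ ∈ O`), `dualBasisMatrix`, `dualBasisMatrix_mul_inv`.
* §2 Runge's **`x ∈ O ⟺ A(x) ∈ M₂(ℤ)`** for REAL pairs: **`isIntegral_transpose_rungeMatrix_mul_diagonal_mul_dualRungeMatrix_iff`**
  (`ᵗR diag(a) S ∈ M₂(ℤ) ⟺ a = σ(x)` for some `x ∈ O`), and its companions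
  **`isIntegral_transpose_dualRungeMatrix_mul_diagonal_mul_rungeMatrix_iff`** (`ᵗS diag(d) R ∈ M₂(ℤ) ⟺ d = σ(w)`, `w ∈ O`),
  **`isIntegral_transpose_rungeMatrix_mul_diagonal_mul_rungeMatrix_iff`** (`ᵗR diag(b) R ∈ M₂(ℤ) ⟺ σ(δ)b = σ(y)`, `y ∈ O`,
  i.e. `b ∈ σ(O^∨)`), **`isIntegral_transpose_dualRungeMatrix_mul_diagonal_mul_dualRungeMatrix_iff`**
  (`ᵗS diag(c) S ∈ M₂(ℤ) ⟺ c = σ(δ)σ(z)`, `z ∈ O`, i.e. `c ∈ σ(δO) = σ((O^∨)⁻¹)` relative to `O^∨`).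
* §3 **`hilbertModularPairGroup k l hΔ`** `:= (range gDHom).comap modularEmbeddingLiftHom` — the subgroup of
  `SL₂(ℝ)²` whose lift lies in `G_1 = gDHom(Sp₄(ℤ))`, and **`mem_hilbertModularPairGroup_iff`**: `g` is in it iff
  `g = (σ(a) σ(b); σ(c) σ(d))` with `a, d ∈ O`, `b ∈ O^∨ = δ⁻¹O`, `c ∈ δO` — **the Hilbert modular group
  `SL(O ⊕ O^∨)` through its two real embeddings**; `translPair_mem_hilbertModularPairGroup`,
  `unitPair_mem_hilbertModularPairGroup`; **`exists_gDHom_smul_eq_modularEmbedding_smul`**: for `g` in the group,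
  `π[R](g·τ) = gDHom(M) · π[R](τ)` for some `M ∈ Sp₄(ℤ)` — so `π[R]` descends to a map
  `SL(O ⊕ O^∨)\ℍ² → Sp₄(ℤ)\𝔥₂ = 𝒜₂` onto the Humbert surface `H_Δ` (row A4-70 FILE 2 `humbertSurface_eq_range`).

Scope: Runge's own normalisation (`ψ_O`, Lemma 4, the extra involution `σ₀`) and the degree of `ℍ² → H_Δ` are not
formalised.
-/

namespace Literature.AlgebraicGeometry.ModuliOfAbelianVarieties.SiegelModuli

open Matrix UpperHalfPlane
open Literature.NumberTheory.Automorphic Literature.NumberTheory.ModularForms.SiegelUpperHalfSpace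

variable {k l : ℤ}

/-! ## §1 `δ = 2ω − l` and the dual basis: `diag(σ(δ)) S = R P` -/

section Delta

/-- `σ₁(δ) = √Δ` for `δ = 2ω − l`. [cite: ElkiesKumar2014HilbertModularSurfaces, §3] -/
theorem realEmb_delta_zero (h : 0 ≤ quadDisc k l) :
    realEmb h 0 (⟨-l, 2⟩ : QuadraticAlgebra ℤ k l) = Real.sqrt (quadDisc k l : ℝ) := by
  rw [realEmb_apply, ← quadRoot_sub (k := k) (l := l)]
  have ha := quadRoot_add k l
  push_cast
  linear_combination ha

/-- `σ₂(δ) = −√Δ`. [cite: ElkiesKumar2014HilbertModularSurfaces, §3] -/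
theorem realEmb_delta_one (h : 0 ≤ quadDisc k l) :
    realEmb h 1 (⟨-l, 2⟩ : QuadraticAlgebra ℤ k l) = -Real.sqrt (quadDisc k l : ℝ) := by
  rw [realEmb_apply, ← quadRoot_sub (k := k) (l := l)]
  have ha := quadRoot_add k l
  push_cast
  linear_combination ha

/-- `σ_s(δ) ≠ 0` for `Δ > 0`. [cite: ElkiesKumar2014HilbertModularSurfaces, §3] -/
theorem realEmb_delta_ne_zero (hΔ : 0 < quadDisc k l) (s : Fin 2) :
    realEmb hΔ.le s (⟨-l, 2⟩ : QuadraticAlgebra ℤ k l) ≠ 0 := by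
  have hs : Real.sqrt (quadDisc k l : ℝ) ≠ 0 := (Real.sqrt_pos.2 (by exact_mod_cast hΔ)).ne'
  fin_cases s
  · simpa [realEmb_delta_zero] using hs
  · simpa [realEmb_delta_one] using hs

/-- **The dual basis in terms of `(1, ω)/δ`: `P = (−l 1; 1 0)`**, i.e. `δω₁^∨ = ω − l = −l·1 + 1·ω`, `δω₂^∨ = 1`
(columns). [cite: ElkiesKumar2014HilbertModularSurfaces, §3] -/
def dualBasisMatrix (l : ℤ) : Matrix (Fin 2) (Fin 2) ℤ := !![-l, 1; 1, 0]

/-- `P⁻¹ = (0 1; 1 l)`: `P (0 1; 1 l) = 1`. [cite: ElkiesKumar2014HilbertModularSurfaces, §3] -/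
theorem dualBasisMatrix_mul_inv (l : ℤ) : dualBasisMatrix l * !![0, 1; 1, l] = 1 := by
  ext i j; fin_cases i <;> fin_cases j <;> simp [dualBasisMatrix]

/-- `(0 1; 1 l) P = 1`. [cite: ElkiesKumar2014HilbertModularSurfaces, §3] -/
theorem dualBasisMatrix_inv_mul (l : ℤ) : !![0, 1; 1, l] * dualBasisMatrix l = 1 := by
  ext i j; fin_cases i <;> fin_cases j <;> simp [dualBasisMatrix]

/-- The same over `ℝ`. [folklore] -/
private theorem dualBasisMatrix_mul_inv_real (l : ℤ) :
    (dualBasisMatrix l).map (Int.cast : ℤ → ℝ) * (!![0, 1; 1, l] : Matrix (Fin 2) (Fin 2) ℤ).map (Int.cast : ℤ → ℝ) = 1 := by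
  have h : (dualBasisMatrix l * !![0, 1; 1, l]).map (Int.cast : ℤ → ℝ) =
      (dualBasisMatrix l).map (Int.cast : ℤ → ℝ) * (!![0, 1; 1, l] : Matrix (Fin 2) (Fin 2) ℤ).map (Int.cast : ℤ → ℝ) :=
    Matrix.map_mul (f := Int.castRingHom ℝ)
  rw [← h, dualBasisMatrix_mul_inv, Matrix.map_one _ Int.cast_zero Int.cast_one]

/-- The same over `ℝ`. [folklore] -/
private theorem dualBasisMatrix_inv_mul_real (l : ℤ) :
    (!![0, 1; 1, l] : Matrix (Fin 2) (Fin 2) ℤ).map (Int.cast : ℤ → ℝ) * (dualBasisMatrix l).map (Int.cast : ℤ → ℝ) = 1 := by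
  have h : (!![0, 1; 1, l] * dualBasisMatrix l).map (Int.cast : ℤ → ℝ) =
      (!![0, 1; 1, l] : Matrix (Fin 2) (Fin 2) ℤ).map (Int.cast : ℤ → ℝ) * (dualBasisMatrix l).map (Int.cast : ℤ → ℝ) :=
    Matrix.map_mul (f := Int.castRingHom ℝ)
  rw [← h, dualBasisMatrix_inv_mul, Matrix.map_one _ Int.cast_zero Int.cast_one]

/-- **KEY: `diag(σ(δ)) S = R P`** — `σ_s(δ)σ_s(ω_j^∨) = σ_s(δω_j^∨)` with `δω₁^∨ = ω − l`, `δω₂^∨ = 1` (`O^∨ = δ⁻¹O`).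
[cite: ElkiesKumar2014HilbertModularSurfaces, §3] [cite: Runge1999EndomorphismRingsAbelianSurfaces, §4 p. 290] -/
theorem diagonal_realEmb_delta_mul_dualRungeMatrix (hΔ : 0 < quadDisc k l) :
    diagonal (fun s ↦ realEmb hΔ.le s (⟨-l, 2⟩ : QuadraticAlgebra ℤ k l)) * dualRungeMatrix k l =
      rungeMatrix k l * (dualBasisMatrix l).map (Int.cast : ℤ → ℝ) := by
  have hs : Real.sqrt (quadDisc k l : ℝ) ≠ 0 := (Real.sqrt_pos.2 (by exact_mod_cast hΔ)).ne'
  have ha := quadRoot_add k l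
  have h0 := realEmb_delta_zero (k := k) (l := l) hΔ.le
  have h1 := realEmb_delta_one (k := k) (l := l) hΔ.le
  ext i j
  fin_cases i <;> fin_cases j <;>
    simp [dualRungeMatrix, rungeMatrix, dualBasisMatrix, Matrix.mul_apply, Fin.sum_univ_two, h0, h1]
  · field_simp; linear_combination (-1 : ℝ) * ha
  · field_simp
  · field_simp; linear_combination (-1 : ℝ) * ha
  · field_simp

end Delta

/-! ## §2 `x ∈ O ⟺ A(x) ∈ M₂(ℤ)` and its companions -/

section Integral

/-- The first column of `R` is `(1, 1)`: `R_{s0} = σ_s(1) = 1`. [folklore] -/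
private theorem rungeMatrix_apply_zero (s : Fin 2) : rungeMatrix k l s 0 = 1 := by
  fin_cases s <;> simp [rungeMatrix]

/-- The second column of `R` is `(σ₁(ω), σ₂(ω))`. [folklore] -/
private theorem rungeMatrix_apply_one (s : Fin 2) : rungeMatrix k l s 1 = quadRoot k l s := by
  fin_cases s <;> simp [rungeMatrix]

/-- **Runge: `x ∈ O ⟺ A(x) ∈ M₂(ℤ)`** — for a real pair `a = (a₁, a₂)` (an element of `F ⊗ ℝ = ℝ²`), the matrix
`ᵗR diag(a) ᵗR⁻¹` of multiplication by `a` on the basis `(1, ω)` is integral iff `a = (σ₁(x), σ₂(x))` for some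
`x ∈ O` (then it is `A(x)`). [cite: Runge1999EndomorphismRingsAbelianSurfaces, §4 p. 290] -/
theorem isIntegral_transpose_rungeMatrix_mul_diagonal_mul_dualRungeMatrix_iff (hΔ : 0 < quadDisc k l) (a : Fin 2 → ℝ) :
    (∃ N : Matrix (Fin 2) (Fin 2) ℤ, (rungeMatrix k l)ᵀ * diagonal a * dualRungeMatrix k l = N.map (Int.cast : ℤ → ℝ)) ↔
      ∃ x : QuadraticAlgebra ℤ k l, a = fun s ↦ realEmb hΔ.le s x := by
  constructor
  · rintro ⟨N, hN⟩
    have hmul : (rungeMatrix k l)ᵀ * diagonal a = N.map (Int.cast : ℤ → ℝ) * (rungeMatrix k l)ᵀ := by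
      rw [← Matrix.mul_one ((rungeMatrix k l)ᵀ * diagonal a), ← dualRungeMatrix_mul_transpose_rungeMatrix k l hΔ,
        ← Matrix.mul_assoc, hN]
    refine ⟨⟨N 0 0, N 0 1⟩, funext fun s ↦ ?_⟩
    have h := congrFun (congrFun hmul 0) s
    rw [Matrix.mul_diagonal, Matrix.transpose_apply, rungeMatrix_apply_zero, one_mul] at h
    simp only [Matrix.mul_apply, Fin.sum_univ_two, Matrix.map_apply, Matrix.transpose_apply, rungeMatrix_apply_zero,
      rungeMatrix_apply_one, mul_one] at h
    rw [realEmb_apply, h]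
  · rintro ⟨x, rfl⟩
    exact ⟨regRep k l x, transpose_rungeMatrix_mul_diagonal_mul_dualRungeMatrix hΔ x⟩

/-- **`ᵗS diag(d) R ∈ M₂(ℤ) ⟺ d = σ(w)`, `w ∈ O`** (the transpose of the previous criterion; then the matrix is
`ᵗA(w)`). [cite: Runge1999EndomorphismRingsAbelianSurfaces, §4 p. 290] -/
theorem isIntegral_transpose_dualRungeMatrix_mul_diagonal_mul_rungeMatrix_iff (hΔ : 0 < quadDisc k l) (d : Fin 2 → ℝ) :
    (∃ N : Matrix (Fin 2) (Fin 2) ℤ, (dualRungeMatrix k l)ᵀ * diagonal d * rungeMatrix k l = N.map (Int.cast : ℤ → ℝ)) ↔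
      ∃ w : QuadraticAlgebra ℤ k l, d = fun s ↦ realEmb hΔ.le s w := by
  rw [← isIntegral_transpose_rungeMatrix_mul_diagonal_mul_dualRungeMatrix_iff hΔ d]
  have ht : ∀ M : Matrix (Fin 2) (Fin 2) ℝ, (dualRungeMatrix k l)ᵀ * diagonal d * rungeMatrix k l = M ↔
      (rungeMatrix k l)ᵀ * diagonal d * dualRungeMatrix k l = Mᵀ := fun M ↦ by
    constructor
    · intro h; rw [← h, transpose_mul, transpose_mul, transpose_transpose, diagonal_transpose, Matrix.mul_assoc]
    · intro h
      rw [← transpose_transpose M, ← h, transpose_mul, transpose_mul, transpose_transpose, diagonal_transpose,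
        Matrix.mul_assoc]
  constructor
  · rintro ⟨N, hN⟩; exact ⟨Nᵀ, by rw [transpose_map]; exact (ht _).1 hN⟩
  · rintro ⟨N, hN⟩; exact ⟨Nᵀ, by rw [transpose_map]; exact (ht _).2 (by rw [transpose_transpose]; exact hN)⟩

/-- **`ᵗR diag(b) R ∈ M₂(ℤ) ⟺ b ∈ σ(O^∨)`, i.e. `σ_s(δ) b_s = σ_s(y)` for some `y ∈ O`** (`O^∨ = δ⁻¹O`; then the
matrix is `A(y) P⁻¹`: `ᵗR diag(b) R = ᵗR diag(δb) S · P⁻¹` by the KEY identity `R = diag(σ(δ)) S P⁻¹`).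
[cite: ElkiesKumar2014HilbertModularSurfaces, §3] [cite: Runge1999EndomorphismRingsAbelianSurfaces, §4 p. 290] -/
theorem isIntegral_transpose_rungeMatrix_mul_diagonal_mul_rungeMatrix_iff (hΔ : 0 < quadDisc k l) (b : Fin 2 → ℝ) :
    (∃ N : Matrix (Fin 2) (Fin 2) ℤ, (rungeMatrix k l)ᵀ * diagonal b * rungeMatrix k l = N.map (Int.cast : ℤ → ℝ)) ↔
      ∃ y : QuadraticAlgebra ℤ k l,
        (fun s ↦ realEmb hΔ.le s (⟨-l, 2⟩ : QuadraticAlgebra ℤ k l) * b s) = fun s ↦ realEmb hΔ.le s y := by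
  -- `R = diag(σ(δ)) S P⁻¹`, so `ᵗR diag(b) R = (ᵗR diag(σ(δ)b) S) P⁻¹`
  have hR : rungeMatrix k l = diagonal (fun s ↦ realEmb hΔ.le s (⟨-l, 2⟩ : QuadraticAlgebra ℤ k l)) *
      dualRungeMatrix k l * (!![0, 1; 1, l] : Matrix (Fin 2) (Fin 2) ℤ).map (Int.cast : ℤ → ℝ) := by
    rw [diagonal_realEmb_delta_mul_dualRungeMatrix hΔ, Matrix.mul_assoc, dualBasisMatrix_mul_inv_real, Matrix.mul_one]
  have hkey : (rungeMatrix k l)ᵀ * diagonal b * rungeMatrix k l =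
      (rungeMatrix k l)ᵀ * diagonal (fun s ↦ realEmb hΔ.le s (⟨-l, 2⟩ : QuadraticAlgebra ℤ k l) * b s) *
        dualRungeMatrix k l * (!![0, 1; 1, l] : Matrix (Fin 2) (Fin 2) ℤ).map (Int.cast : ℤ → ℝ) := by
    conv_lhs => enter [2]; rw [hR]
    have hd : diagonal b * diagonal (fun s ↦ realEmb hΔ.le s (⟨-l, 2⟩ : QuadraticAlgebra ℤ k l)) =
        diagonal (fun s ↦ realEmb hΔ.le s (⟨-l, 2⟩ : QuadraticAlgebra ℤ k l) * b s) := by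
      rw [diagonal_mul_diagonal]; congr 1; ext s; ring
    simp only [← Matrix.mul_assoc]
    rw [Matrix.mul_assoc ((rungeMatrix k l)ᵀ) (diagonal b), hd]
  rw [← isIntegral_transpose_rungeMatrix_mul_diagonal_mul_dualRungeMatrix_iff hΔ, hkey]
  constructor
  · rintro ⟨N, hN⟩
    refine ⟨N * dualBasisMatrix l, ?_⟩
    have hm : (N * dualBasisMatrix l).map (Int.cast : ℤ → ℝ) =
        N.map (Int.cast : ℤ → ℝ) * (dualBasisMatrix l).map (Int.cast : ℤ → ℝ) := Matrix.map_mul (f := Int.castRingHom ℝ)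
    rw [hm, ← hN, Matrix.mul_assoc _ ((!![0, 1; 1, l] : Matrix (Fin 2) (Fin 2) ℤ).map (Int.cast : ℤ → ℝ))
      ((dualBasisMatrix l).map (Int.cast : ℤ → ℝ)), dualBasisMatrix_inv_mul_real, Matrix.mul_one]
  · rintro ⟨N, hN⟩
    refine ⟨N * !![0, 1; 1, l], ?_⟩
    have hm : (N * !![0, 1; 1, l]).map (Int.cast : ℤ → ℝ) =
        N.map (Int.cast : ℤ → ℝ) * (!![0, 1; 1, l] : Matrix (Fin 2) (Fin 2) ℤ).map (Int.cast : ℤ → ℝ) :=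
      Matrix.map_mul (f := Int.castRingHom ℝ)
    rw [hm, hN]

/-- **`ᵗS diag(c) S ∈ M₂(ℤ) ⟺ c ∈ σ(δO)`, i.e. `c_s = σ_s(δ)σ_s(z)` for some `z ∈ O`** (then the matrix is
`ᵗP A(z)`: `ᵗS diag(σ(δ)) = ᵗP ᵗR` by the KEY identity). [cite: ElkiesKumar2014HilbertModularSurfaces, §3] [cite: Runge1999EndomorphismRingsAbelianSurfaces, §4 p. 290] -/
theorem isIntegral_transpose_dualRungeMatrix_mul_diagonal_mul_dualRungeMatrix_iff (hΔ : 0 < quadDisc k l)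
    (c : Fin 2 → ℝ) :
    (∃ N : Matrix (Fin 2) (Fin 2) ℤ,
        (dualRungeMatrix k l)ᵀ * diagonal c * dualRungeMatrix k l = N.map (Int.cast : ℤ → ℝ)) ↔
      ∃ z : QuadraticAlgebra ℤ k l,
        c = fun s ↦ realEmb hΔ.le s (⟨-l, 2⟩ : QuadraticAlgebra ℤ k l) * realEmb hΔ.le s z := by
  set dδ : Fin 2 → ℝ := fun s ↦ realEmb hΔ.le s (⟨-l, 2⟩ : QuadraticAlgebra ℤ k l) with hdδ
  have hne := realEmb_delta_ne_zero (k := k) (l := l) hΔ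
  -- `ᵗS = ᵗP ᵗR diag(σ(δ))⁻¹`
  have hS : (dualRungeMatrix k l)ᵀ = ((dualBasisMatrix l).map (Int.cast : ℤ → ℝ))ᵀ * (rungeMatrix k l)ᵀ *
      diagonal (fun s ↦ (dδ s)⁻¹) := by
    have h := congrArg Matrix.transpose (diagonal_realEmb_delta_mul_dualRungeMatrix hΔ)
    rw [transpose_mul, diagonal_transpose, transpose_mul] at h
    have hdd : diagonal dδ * diagonal (fun s ↦ (dδ s)⁻¹) = 1 := by
      rw [diagonal_mul_diagonal, ← diagonal_one]; congr 1; ext s; exact mul_inv_cancel₀ (hne s)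
    rw [← Matrix.mul_one (dualRungeMatrix k l)ᵀ, ← hdd, ← Matrix.mul_assoc, h]
  have hkey : (dualRungeMatrix k l)ᵀ * diagonal c * dualRungeMatrix k l =
      ((dualBasisMatrix l).map (Int.cast : ℤ → ℝ))ᵀ *
        ((rungeMatrix k l)ᵀ * diagonal (fun s ↦ (dδ s)⁻¹ * c s) * dualRungeMatrix k l) := by
    rw [hS]
    simp only [Matrix.mul_assoc]
    rw [← Matrix.mul_assoc (diagonal _) (diagonal c), diagonal_mul_diagonal]
  have hPt : ((!![0, 1; 1, l] : Matrix (Fin 2) (Fin 2) ℤ).map (Int.cast : ℤ → ℝ))ᵀ *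
      ((dualBasisMatrix l).map (Int.cast : ℤ → ℝ))ᵀ = 1 := by
    rw [← transpose_mul, dualBasisMatrix_mul_inv_real, transpose_one]
  have hPt' : ((dualBasisMatrix l).map (Int.cast : ℤ → ℝ))ᵀ *
      ((!![0, 1; 1, l] : Matrix (Fin 2) (Fin 2) ℤ).map (Int.cast : ℤ → ℝ))ᵀ = 1 := by
    rw [← transpose_mul, dualBasisMatrix_inv_mul_real, transpose_one]
  have hiff : (∃ N : Matrix (Fin 2) (Fin 2) ℤ,
      (dualRungeMatrix k l)ᵀ * diagonal c * dualRungeMatrix k l = N.map (Int.cast : ℤ → ℝ)) ↔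
      ∃ N : Matrix (Fin 2) (Fin 2) ℤ, (rungeMatrix k l)ᵀ * diagonal (fun s ↦ (dδ s)⁻¹ * c s) * dualRungeMatrix k l =
        N.map (Int.cast : ℤ → ℝ) := by
    rw [hkey]
    constructor
    · rintro ⟨N, hN⟩
      refine ⟨(!![0, 1; 1, l] : Matrix (Fin 2) (Fin 2) ℤ)ᵀ * N, ?_⟩
      have hm : ((!![0, 1; 1, l] : Matrix (Fin 2) (Fin 2) ℤ)ᵀ * N).map (Int.cast : ℤ → ℝ) =
          ((!![0, 1; 1, l] : Matrix (Fin 2) (Fin 2) ℤ)ᵀ).map (Int.cast : ℤ → ℝ) * N.map (Int.cast : ℤ → ℝ) :=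
        Matrix.map_mul (f := Int.castRingHom ℝ)
      rw [hm, ← hN, ← Matrix.mul_assoc, transpose_map, hPt, Matrix.one_mul]
    · rintro ⟨N, hN⟩
      refine ⟨(dualBasisMatrix l)ᵀ * N, ?_⟩
      have hm : ((dualBasisMatrix l)ᵀ * N).map (Int.cast : ℤ → ℝ) =
          ((dualBasisMatrix l)ᵀ).map (Int.cast : ℤ → ℝ) * N.map (Int.cast : ℤ → ℝ) := Matrix.map_mul (f := Int.castRingHom ℝ)
      rw [hm, hN, transpose_map]
  rw [hiff, isIntegral_transpose_rungeMatrix_mul_diagonal_mul_dualRungeMatrix_iff hΔ]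
  constructor
  · rintro ⟨z, hz⟩
    refine ⟨z, funext fun s ↦ ?_⟩
    have h : (dδ s)⁻¹ * c s = realEmb hΔ.le s z := congrFun hz s
    rw [← h, ← mul_assoc, mul_inv_cancel₀ (hne s), one_mul]
  · rintro ⟨z, rfl⟩
    refine ⟨z, funext fun s ↦ ?_⟩
    show (dδ s)⁻¹ * (dδ s * realEmb hΔ.le s z) = realEmb hΔ.le s z
    rw [← mul_assoc, inv_mul_cancel₀ (hne s), one_mul]

end Integral

/-! ## §3 The Hilbert modular group `SL(O ⊕ O^∨)` as the pullback of `Sp₄(ℤ)` -/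

section Group

/-- **The pullback `Γ_R = lift⁻¹(G_1)` of `G_1 = gDHom(Sp₄(ℤ))` under Runge's lift `SL₂(ℝ)² → Sp₄(ℝ)`** — the
subgroup of pairs `g` with `(ᵗR 0; 0 R⁻¹) σ(g) (ᵗR 0; 0 R⁻¹)⁻¹ ∈ Sp₄(ℤ)`; by `mem_hilbertModularPairGroup_iff` it is the
Hilbert modular group `SL(O ⊕ O^∨)` through its two real embeddings. [cite: Runge1999EndomorphismRingsAbelianSurfaces, §4 p. 291 ("the Humbert modular group `Γ(F) = Γ(Δ)`")] [cite: ElkiesKumar2014HilbertModularSurfaces, §3] -/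
noncomputable def hilbertModularPairGroup (k l : ℤ) (hΔ : 0 < quadDisc k l) :
    Subgroup (Fin 2 → Matrix.SpecialLinearGroup (Fin 2) ℝ) :=
  ((gDHom (fun _ : Fin 2 ↦ 1) principalType_pos).range).comap (modularEmbeddingLiftHom k l hΔ)

/-- Membership: the lift lies in `G_1 = range gDHom`. [cite: Runge1999EndomorphismRingsAbelianSurfaces, §4 p. 291] -/
theorem mem_hilbertModularPairGroup_iff_mem_range (hΔ : 0 < quadDisc k l) (g : Fin 2 → Matrix.SpecialLinearGroup (Fin 2) ℝ) :
    g ∈ hilbertModularPairGroup k l hΔ ↔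
      modularEmbeddingLift k l hΔ g ∈ (gDHom (fun _ : Fin 2 ↦ 1) principalType_pos).range :=
  Iff.rfl

/-- **`range gDHom` = the images `toGD 1 M = ᵗM` of the integral symplectic matrices `M` (`ᵗM E₁ M = E₁`).**
[cite: Lange2023AbelianVarietiesComplex, §3.1.4 (3.8) and §8.2 (8.5)] -/
theorem mem_range_gDHom_one_iff (A : Matrix.symplecticGroup (Fin 2) ℝ) :
    A ∈ (gDHom (fun _ : Fin 2 ↦ 1) principalType_pos).range ↔
      ∃ M : Matrix (Fin 2 ⊕ Fin 2) (Fin 2 ⊕ Fin 2) ℤ, Mᵀ * typeForm (fun _ : Fin 2 ↦ 1) * M = typeForm (fun _ : Fin 2 ↦ 1) ∧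
        toGD (fun _ : Fin 2 ↦ 1) M = (A : Matrix (Fin 2 ⊕ Fin 2) (Fin 2 ⊕ Fin 2) ℝ) := by
  constructor
  · rintro ⟨M, rfl⟩
    exact ⟨((M⁻¹ : symplecticLatticeGroup (fun _ : Fin 2 ↦ 1)) : GL (Fin 2 ⊕ Fin 2) ℤ),
      mem_symplecticLatticeGroup_iff.1 (M⁻¹).2, (coe_gDHom principalType_pos M).symm⟩
  · rintro ⟨M, hM, hA⟩
    refine ⟨(spUnit M hM)⁻¹, ?_⟩
    rw [map_inv, gDHom_spUnit, inv_inv]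
    exact Subtype.ext hA

/-- Blocks of `ᵗ(M cast)` are casts of blocks of `ᵗM`. [folklore] -/
private theorem toBlocks_transpose_map (M : Matrix (Fin 2 ⊕ Fin 2) (Fin 2 ⊕ Fin 2) ℤ) :
    ((M.map (Int.cast : ℤ → ℝ))ᵀ).toBlocks₁₁ = (Mᵀ.toBlocks₁₁).map (Int.cast : ℤ → ℝ) ∧
    ((M.map (Int.cast : ℤ → ℝ))ᵀ).toBlocks₁₂ = (Mᵀ.toBlocks₁₂).map (Int.cast : ℤ → ℝ) ∧
    ((M.map (Int.cast : ℤ → ℝ))ᵀ).toBlocks₂₁ = (Mᵀ.toBlocks₂₁).map (Int.cast : ℤ → ℝ) ∧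
    ((M.map (Int.cast : ℤ → ℝ))ᵀ).toBlocks₂₂ = (Mᵀ.toBlocks₂₂).map (Int.cast : ℤ → ℝ) :=
  ⟨rfl, rfl, rfl, rfl⟩

/-- `(J ℤ) cast = J ℝ`. [folklore] -/
private theorem map_J_int : (Matrix.J (Fin 2) ℤ).map (Int.cast : ℤ → ℝ) = Matrix.J (Fin 2) ℝ :=
  Matrix.map_J (Fin 2) (Int.castRingHom ℝ)

/-- An integral matrix whose cast is in `Sp₄(ℝ)` is integral symplectic: `ᵗ(ᵗL) E₁ ᵗL = E₁`. [folklore] -/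
private theorem transpose_symplectic_of_map_mem {L : Matrix (Fin 2 ⊕ Fin 2) (Fin 2 ⊕ Fin 2) ℤ}
    (hL : L.map (Int.cast : ℤ → ℝ) ∈ Matrix.symplecticGroup (Fin 2) ℝ) :
    (Lᵀ)ᵀ * typeForm (fun _ : Fin 2 ↦ 1) * Lᵀ = typeForm (fun _ : Fin 2 ↦ 1) := by
  rw [SymplecticGroup.mem_iff] at hL
  have hZ : L * Matrix.J (Fin 2) ℤ * Lᵀ = Matrix.J (Fin 2) ℤ := by
    apply Matrix.map_injective (Int.cast_injective (α := ℝ))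
    have h1 : (L * Matrix.J (Fin 2) ℤ * Lᵀ).map (Int.cast : ℤ → ℝ) =
        (L * Matrix.J (Fin 2) ℤ).map (Int.cast : ℤ → ℝ) * (Lᵀ).map (Int.cast : ℤ → ℝ) :=
      Matrix.map_mul (f := Int.castRingHom ℝ)
    have h2 : (L * Matrix.J (Fin 2) ℤ).map (Int.cast : ℤ → ℝ) =
        L.map (Int.cast : ℤ → ℝ) * (Matrix.J (Fin 2) ℤ).map (Int.cast : ℤ → ℝ) := Matrix.map_mul (f := Int.castRingHom ℝ)
    simp only [h1, h2, map_J_int, transpose_map]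
    exact hL
  rw [transpose_transpose, typeForm_one_eq_neg_J, Matrix.mul_neg, Matrix.neg_mul, hZ]

/-- **THE PULLBACK OF `Sp₄(ℤ)` IS `SL(O ⊕ O^∨)`**: `g = (g₁, g₂) ∈ SL₂(ℝ)²` lifts into `G_1 = gDHom(Sp₄(ℤ))` iff
`g_s = (σ_s(a) σ_s(b); σ_s(c) σ_s(d))` with `a, d ∈ O`, `b ∈ O^∨ = δ⁻¹O` (`σ_s(δ)b_s = σ_s(y)`, `y ∈ O`) and `c ∈ δO`
(`c_s = σ_s(δ)σ_s(z)`, `z ∈ O`), `δ = 2ω − l` — Runge's "`x ∈ O ⟺ A(x) ∈ M₂(ℤ)`" block by block.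
[cite: Runge1999EndomorphismRingsAbelianSurfaces, §4 pp. 290–291] [cite: ElkiesKumar2014HilbertModularSurfaces, §3 (`SL(O_D ⊕ O_D^*)`)] -/
theorem mem_hilbertModularPairGroup_iff (hΔ : 0 < quadDisc k l) (g : Fin 2 → Matrix.SpecialLinearGroup (Fin 2) ℝ) :
    g ∈ hilbertModularPairGroup k l hΔ ↔
      ∃ x w y z : QuadraticAlgebra ℤ k l, ∀ s : Fin 2,
        (g s 0 0 : ℝ) = realEmb hΔ.le s x ∧ (g s 1 1 : ℝ) = realEmb hΔ.le s w ∧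
        realEmb hΔ.le s (⟨-l, 2⟩ : QuadraticAlgebra ℤ k l) * (g s 0 1 : ℝ) = realEmb hΔ.le s y ∧
        (g s 1 0 : ℝ) = realEmb hΔ.le s (⟨-l, 2⟩ : QuadraticAlgebra ℤ k l) * realEmb hΔ.le s z := by
  rw [mem_hilbertModularPairGroup_iff_mem_range, mem_range_gDHom_one_iff]
  constructor
  · rintro ⟨M, hM, hT⟩
    rw [toGD_one_eq_transpose, coe_modularEmbeddingLift] at hT
    obtain ⟨h11, h12, h21, h22⟩ := toBlocks_transpose_map M
    have hA := congrArg Matrix.toBlocks₁₁ hT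
    have hB := congrArg Matrix.toBlocks₁₂ hT
    have hC := congrArg Matrix.toBlocks₂₁ hT
    have hD := congrArg Matrix.toBlocks₂₂ hT
    rw [Matrix.toBlocks_fromBlocks₁₁, h11] at hA
    rw [Matrix.toBlocks_fromBlocks₁₂, h12] at hB
    rw [Matrix.toBlocks_fromBlocks₂₁, h21] at hC
    rw [Matrix.toBlocks_fromBlocks₂₂, h22] at hD
    obtain ⟨x, hx⟩ := (isIntegral_transpose_rungeMatrix_mul_diagonal_mul_dualRungeMatrix_iff hΔ _).1 ⟨_, hA.symm⟩
    obtain ⟨y, hy⟩ := (isIntegral_transpose_rungeMatrix_mul_diagonal_mul_rungeMatrix_iff hΔ _).1 ⟨_, hB.symm⟩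
    obtain ⟨z, hz⟩ := (isIntegral_transpose_dualRungeMatrix_mul_diagonal_mul_dualRungeMatrix_iff hΔ _).1 ⟨_, hC.symm⟩
    obtain ⟨w, hw⟩ := (isIntegral_transpose_dualRungeMatrix_mul_diagonal_mul_rungeMatrix_iff hΔ _).1 ⟨_, hD.symm⟩
    exact ⟨x, w, y, z, fun s ↦ ⟨congrFun hx s, congrFun hw s, congrFun hy s, congrFun hz s⟩⟩
  · rintro ⟨x, w, y, z, h⟩
    have hx : (fun s ↦ (g s 0 0 : ℝ)) = fun s ↦ realEmb hΔ.le s x := funext fun s ↦ (h s).1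
    have hw : (fun s ↦ (g s 1 1 : ℝ)) = fun s ↦ realEmb hΔ.le s w := funext fun s ↦ (h s).2.1
    have hy : (fun s ↦ realEmb hΔ.le s (⟨-l, 2⟩ : QuadraticAlgebra ℤ k l) * (g s 0 1 : ℝ)) =
        fun s ↦ realEmb hΔ.le s y := funext fun s ↦ (h s).2.2.1
    have hz : (fun s ↦ (g s 1 0 : ℝ)) =
        fun s ↦ realEmb hΔ.le s (⟨-l, 2⟩ : QuadraticAlgebra ℤ k l) * realEmb hΔ.le s z := funext fun s ↦ (h s).2.2.2
    obtain ⟨N₁, hN₁⟩ := (isIntegral_transpose_rungeMatrix_mul_diagonal_mul_dualRungeMatrix_iff hΔ _).2 ⟨x, hx⟩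
    obtain ⟨N₂, hN₂⟩ := (isIntegral_transpose_rungeMatrix_mul_diagonal_mul_rungeMatrix_iff hΔ _).2 ⟨y, hy⟩
    obtain ⟨N₃, hN₃⟩ := (isIntegral_transpose_dualRungeMatrix_mul_diagonal_mul_dualRungeMatrix_iff hΔ _).2 ⟨z, hz⟩
    obtain ⟨N₄, hN₄⟩ := (isIntegral_transpose_dualRungeMatrix_mul_diagonal_mul_rungeMatrix_iff hΔ _).2 ⟨w, hw⟩
    have hL : (Matrix.fromBlocks N₁ N₂ N₃ N₄).map (Int.cast : ℤ → ℝ) =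
        ((modularEmbeddingLift k l hΔ g : Matrix.symplecticGroup (Fin 2) ℝ) : Matrix (Fin 2 ⊕ Fin 2) (Fin 2 ⊕ Fin 2) ℝ) := by
      rw [coe_modularEmbeddingLift, Matrix.fromBlocks_map, ← hN₁, ← hN₂, ← hN₃, ← hN₄]
    refine ⟨(Matrix.fromBlocks N₁ N₂ N₃ N₄)ᵀ, transpose_symplectic_of_map_mem (hL ▸ (modularEmbeddingLift k l hΔ g).2), ?_⟩
    rw [toGD_one_eq_transpose, ← transpose_map, transpose_transpose, hL]

/-- **For `g ∈ SL(O ⊕ O^∨)` the point `π[R](g·τ)` is `Sp₄(ℤ)`-equivalent to `π[R](τ)`**: `π[R](g·τ) = gDHom(M)·π[R](τ)`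
for some `M ∈ Sp₄(ℤ)` — Runge's embedding descends to `SL(O ⊕ O^∨)\(ℍ × ℍ) → Sp₄(ℤ)\𝔥₂ = 𝒜₂` ("by taking the quotient
`Γ(F)\H(F)`, we get the standard model for Humbert surfaces"). [cite: Runge1999EndomorphismRingsAbelianSurfaces, §4 p. 291] [cite: ElkiesKumar2014HilbertModularSurfaces, §3] -/
theorem exists_gDHom_smul_eq_modularEmbedding_smul (hΔ : 0 < quadDisc k l)
    {g : Fin 2 → Matrix.SpecialLinearGroup (Fin 2) ℝ} (hg : g ∈ hilbertModularPairGroup k l hΔ) (τ : Fin 2 → ℍ) :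
    ∃ M : symplecticLatticeGroup (fun _ : Fin 2 ↦ 1),
      modularEmbedding k l hΔ (fun s ↦ g s • τ s) = gDHom (fun _ : Fin 2 ↦ 1) principalType_pos M • modularEmbedding k l hΔ τ := by
  obtain ⟨M, hM⟩ := hg
  exact ⟨M, by rw [modularEmbedding_smul, ← modularEmbeddingLiftHom_apply, ← hM]⟩

/-- **The translations by `O` belong to `SL(O ⊕ O^∨)`.** [cite: Runge1999EndomorphismRingsAbelianSurfaces, §4 p. 291] -/
theorem translPair_mem_hilbertModularPairGroup (hΔ : 0 < quadDisc k l) (x : QuadraticAlgebra ℤ k l) :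
    translPair (fun s ↦ realEmb hΔ.le s x) ∈ hilbertModularPairGroup k l hΔ := by
  refine ⟨(spUnit _ (translSpInt_symplectic x))⁻¹, ?_⟩
  rw [map_inv, gDHom_spUnit, inv_inv, modularEmbeddingLiftHom_apply, modularEmbeddingLift_translPair_eq]

/-- **The unit pairs `diag(σ(ε), σ(ε⁻¹))` belong to `SL(O ⊕ O^∨)`.** [cite: Runge1999EndomorphismRingsAbelianSurfaces, §4 p. 291] -/
theorem unitPair_mem_hilbertModularPairGroup (hΔ : 0 < quadDisc k l) (ε ε' : QuadraticAlgebra ℤ k l) (h : ε * ε' = 1) :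
    unitPair hΔ ε ε' h ∈ hilbertModularPairGroup k l hΔ := by
  have hWV : (regRep k l ε')ᵀ * (regRep k l ε)ᵀ = 1 := by
    rw [← transpose_mul, ← regRep_mul, h, regRep_one, transpose_one]
  refine ⟨(spUnit _ (transpose_blockDiag_mul_typeForm_mul hWV))⁻¹, ?_⟩
  rw [map_inv, gDHom_spUnit, inv_inv, modularEmbeddingLiftHom_apply, modularEmbeddingLift_unitPair]
  rfl

end Group

end Literature.AlgebraicGeometry.ModuliOfAbelianVarieties.SiegelModuli
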